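import Literature.NumberTheory.Automorphic.Liu2021.AppendixC.TowerMorphismBettiComparison
import Literature.NumberTheory.Automorphic.Liu2021.AppendixC.AlbaneseH1Comparison
import HarnessLib

/-!
# [Liu 2021, Lem. 2.4 (1) / Def. 2.3 along a morphism of towers] the Betti pull-back along `Alb(Sh(φ)_K)` IS the pull-back
# along `Sh(φ)_K` itself under `H¹_{B,τ'}(Alb_X, ℂ) ≅ H¹_{B,τ'}(X, ℂ)` — and the full Betti–étale square of [Thm. 4.15]'s seesaw

Topic `NumberTheory/Automorphic/Liu2021/AppendixC`; namespace `Literature.NumberTheory.Automorphic.Liu2021.AppendixC`.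
Continuation of `TowerMorphismBettiComparison.lean` (the étale pull-back `etPull` along `M : Sec42Data.TowerHom …` IS the Betti
pull-back along `Alb(Sh(φ)_K) = M.albMap K` under the comparison `cmpAlong`, with the pinned-tower pull-back `bettiPull`) and of
`AlbaneseH1Comparison.lean` (the hypothesis structure `AlbaneseH1ComparisonFamily k τ'`: ONE comparison
`cmp X a : H¹_{B,τ'}(Alb_X, ℂ) → H¹_{B,τ'}(X, ℂ)` per `(X, a)`, bijective on smooth projective `X`, natural for α-compatible pairs —
[Liu2021] Lem. 2.4 (1) with Def. 2.3).

THE POINT.  The detection input of the proof of [Liu2021, Thm. 4.15] (p. 51, l. 2212: «the image of `c` under the restriction map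
`H¹_B(Sh(G,h), ℂ) → H¹_B(Sh(G⋆,h⋆), ℂ)` is nonzero», after [MurtyRamakrishnan1992] Prop. 6; in the tree row III-8′
`MR92Prop6Source`, complex Betti cohomology of the VARIETY) speaks about `H¹` of the Shimura varieties `X_K`, whereas the towers of
§4.2–4.3 are built on `H¹` of their ALBANESE varieties `A_K = Alb_{X_K}` (l. 2066–2081).  Lemma 2.4 (1) («a canonical isomorphism
`H¹_{B,τ}(Alb_X, ℚ) ≃ H¹_{B,τ}(X, ℚ)`», l. 1210–1213) with the canonicity of Def. 2.3 («`Alb_u ∘ α_X = α_Y ∘ ∇u`», l. 1206–1208)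
bridges the two, NATURALLY in the morphism `Sh(φ)_K : X⋆_{φ⁻¹K ∩ K₀⋆} → X_K` of a morphism of towers.  This file feeds the
naturality field of `AlbaneseH1ComparisonFamily` with the data a `Sec42Data.TowerHom` ALREADY carries — `∇(Sh(φ)_K)` (★ `Nabla.map`
with ★ `Nabla.map_incl`), `Alb(Sh(φ)_K) = M.albMap K` with its printed identity (★ `TowerHom.α_albMap`), smoothness and projectivity
of both levels (★ `CompactifiedSystem.smooth_X` ∕ `projective_X`) — so that NO hypothesis beyond `(M, cA)` remains:

* §1 `Sec42Data.TowerHom.albCmp_bettiPullAlong_albMap : cA.cmp X⋆ a⋆ (Alb(Sh(φ)_K)^* y) = (Sh(φ)_K ×_{τ'} ℂ)^* (cA.cmp X_K a_K y)`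
  and its `cmpEquiv.symm` sibling;
* §2 with the pinnings and the étale comparison of `TowerMorphismBettiComparison.lean`: THE FULL SQUARE
  `cmpₛ (bₛ ((cAₛ)⁻¹ ((Sh(φ)_K ×_{τ'} ℂ)^* z))) = (1 ⊗ etPull) (cmp (b_K (cA⁻¹ z)))` for a class `z ∈ H¹((X_K ×_{τ'} ℂ)(ℂ); ℂ)`, and
  the NONVANISHING TRANSFER IN SCHEME CURRENCY `(1 ⊗ etPull) (cmp (b_K (cA⁻¹ z))) ≠ 0 ↔ (Sh(φ)_K ×_{τ'} ℂ)^* z ≠ 0` — the currency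
  of row III-8′'s output — for the étale receptacle `EtaleTowerHom` and for the lifted `M.toEtaleTowerHom.etPull` of a geometric
  `TowerHom` (the form the first clause of `S34SomeSource` quantifies).

THEOREMS ONLY: NO definition, NO named fact, NO instance, NO `sorry`; net Literature debt 0.  The comparison family `cA` is a
HYPOTHESIS (structure `AlbaneseH1ComparisonFamily`; its inhabitant from Lem. 2.4 (1) is the consumer's — e.g. the cell's
`albaneseH1ComparisonFamily_of_lemma24`).  Deliberately NOT here: any particular source, piece decompositions of `X_K(ℂ)`, the
detection statement.  Cell `hodgecm-mathlib`, line `a3_liu418` (item hLiu418 = [Liu2021, Thm. 4.18]); GS-PROGRAMME §4 F2 (Betti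
half).  HC_CM is proved only modulo the 7 printed citations until rung 0 closes; this file discharges none of them by itself.

## References
* [Liu2021] Y. Liu, *Fourier–Jacobi cycles and arithmetic relative trace formula*, Camb. J. Math. 9 (2021) = arXiv:2102.11518
  (`FJcycle.tex`): Def. 2.3 l. 1202–1208; Lem. 2.4 (1) l. 1210–1228; §4.2 l. 2066–2081; §4.3 l. 2154–2160; Thm. 4.15 proof l. 2193–2213.
* [Milne2005ShimuraVarieties] J. S. Milne, *Introduction to Shimura varieties*, Clay Math. Proc. 4 (2005), Thm. 13.6 p. 118.
* [SGA4Tome3] M. Artin, A. Grothendieck, J.-L. Verdier, SGA 4 Tome 3, Exp. XI Thm. 4.4.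
* Tree: `AppendixC.TowerMorphism` (`TowerHom`, `albMap`, `α_albMap`), `AppendixC.AlbaneseFunctorial` (`Nabla.map`, `Nabla.map_incl`),
  `AppendixC.Glue` (`CompactifiedSystem.smooth_X`, `projective_X`), `AppendixC.AlbaneseH1Comparison` (`AlbaneseH1ComparisonFamily`,
  `cmpEquiv`, `schemeBettiPullAlong`), `AppendixC.TowerMorphismBettiComparison` (`baseChange_etPull_cmpAlong_b_ne_zero_iff`, …).
-/

set_option autoImplicit false

noncomputable section

open CategoryTheory NumberField Function
open scoped TensorProduct

namespace Literature.NumberTheory.Automorphic.Liu2021.AppendixC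

open Literature.AlgebraicGeometry.Motives (AbelianVariety)

variable {F E : Type} [Field F] [NumberField F] [IsTotallyReal F] [Field E] [NumberField E] [Algebra F E]
  [IsTotallyComplex E] [Algebra.IsQuadraticExtension F E]
variable {P5ₛ P5 : PropC5Data F E} {isoₛ iso : ℕ → Prop}

/-! ## §1 Lemma 2.4 (1) is natural in `Sh(φ)_K`: `cmp_{X⋆} ∘ Alb(Sh(φ)_K)^* = (Sh(φ)_K ×_{τ'} ℂ)^* ∘ cmp_{X_K}` -/

namespace Sec42Data.TowerHom

variable {Cₛ : Sec42Data P5ₛ isoₛ} {C : Sec42Data P5 iso} {Tₛ : Cₛ.HeckeTranslates} {T : C.HeckeTranslates}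
  {φ : Cₛ.G →* C.G} {hφ : Continuous φ} (M : Sec42Data.TowerHom Cₛ C Tₛ T φ hφ)
variable {τ' : E →+* ℂ} (cA : AlbaneseH1ComparisonFamily E τ')

/-- **Lemma 2.4 (1) along a morphism of towers**: `cmp_{X⋆} (Alb(Sh(φ)_K)^* y) = (Sh(φ)_K ×_{τ'} ℂ)^* (cmp_{X_K} y)` for every small `K`
and every `y ∈ H¹_{B,τ'}(A_K, ℂ)` — the naturality field of the Albanese comparison family at the α-compatible pair
`(Sh(φ)_K, ∇(Sh(φ)_K), Alb(Sh(φ)_K))` (Def. 2.3 «`Alb_u ∘ α_X = α_Y ∘ ∇u`»: ★ `Nabla.map_incl`, ★ `TowerHom.α_albMap`), both levels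
being smooth projective (★ `CompactifiedSystem.smooth_X` ∕ `projective_X`, §4.2 l. 2064). [cite: Liu2021, Lem. 2.4 (1) (FJcycle.tex l. 1210–1213) with Def. 2.3 (l. 1206–1208); §4.2 l. 2064–2074]
[cite: Milne2005ShimuraVarieties, Thm. 13.6 p. 118] -/
theorem albCmp_bettiPullAlong_albMap (K : C5.SmallLevel C.S.K₀) (y : C.bettiH1 τ' K) :
    cA.cmp (Cₛ.X (M.src K)) (Cₛ.alb (M.src K)) (bettiPullAlong τ' (M.albMap K) y) =
      schemeBettiPullAlong τ' (M.map K) (cA.cmp (C.X K) (C.alb K) y) :=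
  cA.natural (Cₛ.alb (M.src K)) (C.alb K) _ _ (Cₛ.cpt.smooth_X (M.src K)) (Cₛ.cpt.projective_X (M.src K))
    (C.cpt.smooth_X K) (C.cpt.projective_X K) (M.map K) _ (M.albMap K)
    ((Cₛ.alb (M.src K)).nabla.map_incl (C.alb K).nabla (M.map K)) (M.α_albMap K) y

/-- The same as an identity of `ℂ`-linear maps `H¹_{B,τ'}(A_K, ℂ) → H¹_{B,τ'}(X⋆_{φ⁻¹K ∩ K₀⋆}, ℂ)`.
[cite: Liu2021, Lem. 2.4 (1) (FJcycle.tex l. 1210–1213) with Def. 2.3 (l. 1206–1208)] -/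
theorem albCmp_comp_bettiPullAlong_albMap (K : C5.SmallLevel C.S.K₀) :
    cA.cmp (Cₛ.X (M.src K)) (Cₛ.alb (M.src K)) ∘ₗ bettiPullAlong τ' (M.albMap K) =
      schemeBettiPullAlong τ' (M.map K) ∘ₗ cA.cmp (C.X K) (C.alb K) :=
  LinearMap.ext fun y => M.albCmp_bettiPullAlong_albMap cA K y

/-- **The inverse direction**: `(cmp_{X⋆})⁻¹ ((Sh(φ)_K ×_{τ'} ℂ)^* z) = Alb(Sh(φ)_K)^* ((cmp_{X_K})⁻¹ z)` for a class
`z ∈ H¹((X_K ×_{τ'} ℂ)(ℂ); ℂ)` of the VARIETY (the currency of the detection input) — ★ `cmpEquiv_symm_schemeBettiPullAlong`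
fed by name. [cite: Liu2021, Lem. 2.4 (1) (FJcycle.tex l. 1210–1213) with Def. 2.3 (l. 1206–1208); Thm. 4.15 proof l. 2212] -/
theorem albCmpEquiv_symm_schemeBettiPullAlong_map (K : C5.SmallLevel C.S.K₀) (z : schemeBettiH1Along (C.X K) τ') :
    (cA.cmpEquiv (Cₛ.X (M.src K)) (Cₛ.alb (M.src K)) (Cₛ.cpt.smooth_X (M.src K)) (Cₛ.cpt.projective_X (M.src K))).symm
        (schemeBettiPullAlong τ' (M.map K) z) =
      bettiPullAlong τ' (M.albMap K)
        ((cA.cmpEquiv (C.X K) (C.alb K) (C.cpt.smooth_X K) (C.cpt.projective_X K)).symm z) :=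
  cA.cmpEquiv_symm_schemeBettiPullAlong (Cₛ.alb (M.src K)) (C.alb K) (Cₛ.cpt.smooth_X (M.src K))
    (Cₛ.cpt.projective_X (M.src K)) (C.cpt.smooth_X K) (C.cpt.projective_X K) (M.map K) _ (M.albMap K)
    ((Cₛ.alb (M.src K)).nabla.map_incl (C.alb K).nabla (M.map K)) (M.α_albMap K) z

/-- **Nonvanishing, Albanese ↔ variety**: `Alb(Sh(φ)_K)^* y = 0 ↔ (Sh(φ)_K ×_{τ'} ℂ)^* (cmp_{X_K} y) = 0` (`cmp_{X⋆}` is injective on the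
smooth projective source level). [cite: Liu2021, Lem. 2.4 (1) (FJcycle.tex l. 1210–1213); Thm. 4.15 proof l. 2212] -/
theorem bettiPullAlong_albMap_eq_zero_iff (K : C5.SmallLevel C.S.K₀) (y : C.bettiH1 τ' K) :
    bettiPullAlong τ' (M.albMap K) y = 0 ↔ schemeBettiPullAlong τ' (M.map K) (cA.cmp (C.X K) (C.alb K) y) = 0 := by
  rw [← M.albCmp_bettiPullAlong_albMap cA K y]
  exact (map_eq_zero_iff _ (cA.cmp_injective (Cₛ.X (M.src K)) (Cₛ.alb (M.src K)) (Cₛ.cpt.smooth_X (M.src K))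
    (Cₛ.cpt.projective_X (M.src K)))).symm

/-- The same from a VARIETY class `z`: `Alb(Sh(φ)_K)^* ((cmp_{X_K})⁻¹ z) = 0 ↔ (Sh(φ)_K ×_{τ'} ℂ)^* z = 0`.
[cite: Liu2021, Lem. 2.4 (1) (FJcycle.tex l. 1210–1213); Thm. 4.15 proof l. 2212] -/
theorem bettiPullAlong_albMap_cmpEquiv_symm_eq_zero_iff (K : C5.SmallLevel C.S.K₀) (z : schemeBettiH1Along (C.X K) τ') :
    bettiPullAlong τ' (M.albMap K) ((cA.cmpEquiv (C.X K) (C.alb K) (C.cpt.smooth_X K) (C.cpt.projective_X K)).symm z) = 0 ↔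
      schemeBettiPullAlong τ' (M.map K) z = 0 := by
  rw [M.bettiPullAlong_albMap_eq_zero_iff cA K, ← AlbaneseH1ComparisonFamily.cmpEquiv_apply cA (C.X K) (C.alb K)
    (C.cpt.smooth_X K) (C.cpt.projective_X K), LinearEquiv.apply_symm_apply]

end Sec42Data.TowerHom

/-! ## §2 The full Betti–étale square of the seesaw and the nonvanishing transfer in scheme currency -/

namespace Sec42Data.EtaleTowerHom

variable {Cₛ : Sec42Data P5ₛ isoₛ} {C : Sec42Data P5 iso} {Tₛ : Cₛ.HeckeTranslates} {T : C.HeckeTranslates}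
  {φ : Cₛ.G →* C.G} {hφ : Continuous φ} (M : Sec42Data.EtaleTowerHom Cₛ C Tₛ T φ hφ) (ℓ : ℕ) [Fact ℓ.Prime]
variable {τ' : E →+* ℂ} (ι : ℂ ≃+* AlgebraicClosure ℚ_[ℓ]) (c : H1ComparisonFamily (E := E) τ' ℓ ι)
  (cA : AlbaneseH1ComparisonFamily E τ')
variable {H Hₛ : Type} [AddCommGroup H] [Module ℂ H] [AddCommGroup Hₛ] [Module ℂ Hₛ]
  {rhoB : Representation ℂ C.G H} {rhoBₛ : Representation ℂ Cₛ.G Hₛ}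
  (B : C.BettiPinning T τ' H rhoB) (Bₛ : Cₛ.BettiPinning Tₛ τ' Hₛ rhoBₛ)

/-- **THE FULL SQUARE** `H¹((X_K ×_{τ'} ℂ)(ℂ); ℂ) → ℚ_ℓ^{ac} ⊗ H¹_ét(A⋆_∞)`: for a class `z` of the VARIETY `X_K`,
`cmpₛ (bₛ ((cmp_{X⋆})⁻¹ ((Sh(φ)_K ×_{τ'} ℂ)^* z))) = (1 ⊗ etPull) (cmp (b_K ((cmp_{X_K})⁻¹ z)))` — restriction to the sub-Shimura
variety in Betti cohomology of the varieties (l. 2212), then Lemma 2.4 (1) and the comparison, EQUALS the étale pull-back of the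
compared class (§4.3 l. 2154–2160 with Thm. 4.18 proof l. 2254–2262). [cite: Liu2021, Thm. 4.15 proof (FJcycle.tex l. 2193–2213); Lem. 2.4 (1); §4.3 l. 2154–2160]
[cite: SGA4Tome3, Exp. XI Thm. 4.4] [cite: Milne2005ShimuraVarieties, Thm. 13.6 p. 118] -/
theorem cmpAlong_b_albCmpEquiv_symm_schemeBettiPullAlong (K : C5.SmallLevel C.S.K₀) (z : schemeBettiH1Along (C.X K) τ') :
    Bₛ.cmpAlong ℓ ι c (Bₛ.b (M.src K)
        ((cA.cmpEquiv (Cₛ.X (M.src K)) (Cₛ.alb (M.src K)) (Cₛ.cpt.smooth_X (M.src K)) (Cₛ.cpt.projective_X (M.src K))).symm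
          (schemeBettiPullAlong τ' (M.map K) z))) =
      (M.etPull ℓ).baseChange (AlgebraicClosure ℚ_[ℓ])
        (B.cmpAlong ℓ ι c (B.b K ((cA.cmpEquiv (C.X K) (C.alb K) (C.cpt.smooth_X K) (C.cpt.projective_X K)).symm z))) := by
  rw [M.albCmpEquiv_symm_schemeBettiPullAlong_map cA K z, M.baseChange_etPull_cmpAlong_b ℓ ι c B Bₛ K]

/-- **NONVANISHING TRANSFER IN SCHEME CURRENCY**: for a class `z ∈ H¹((X_K ×_{τ'} ℂ)(ℂ); ℂ)` of the variety,
`(1 ⊗ etPull) (cmp (b_K ((cmp_{X_K})⁻¹ z))) ≠ 0 ↔ (Sh(φ)_K ×_{τ'} ℂ)^* z ≠ 0` — «the image of `c` under the restriction map … is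
nonzero» (l. 2212) IMPLIES the étale pull-back clause, and conversely. [cite: Liu2021, Thm. 4.15 proof (FJcycle.tex l. 2212); Lem. 2.4 (1); §4.3 l. 2154–2160]
[cite: SGA4Tome3, Exp. XI Thm. 4.4] -/
theorem baseChange_etPull_cmpAlong_b_albCmpEquiv_symm_ne_zero_iff (Bₛ : Cₛ.BettiPinning Tₛ τ' Hₛ rhoBₛ)
    (K : C5.SmallLevel C.S.K₀) (z : schemeBettiH1Along (C.X K) τ') :
    (M.etPull ℓ).baseChange (AlgebraicClosure ℚ_[ℓ])
        (B.cmpAlong ℓ ι c (B.b K ((cA.cmpEquiv (C.X K) (C.alb K) (C.cpt.smooth_X K) (C.cpt.projective_X K)).symm z))) ≠ 0 ↔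
      schemeBettiPullAlong τ' (M.map K) z ≠ 0 := by
  rw [M.baseChange_etPull_cmpAlong_b_ne_zero_iff ℓ ι c B Bₛ K, Ne,
    M.bettiPullAlong_albMap_cmpEquiv_symm_eq_zero_iff cA K z]

/-- The same for an ALBANESE class `y`: `(1 ⊗ etPull) (cmp (b_K y)) ≠ 0 ↔ (Sh(φ)_K ×_{τ'} ℂ)^* (cmp_{X_K} y) ≠ 0`.
[cite: Liu2021, Thm. 4.15 proof (FJcycle.tex l. 2212); Lem. 2.4 (1); §4.3 l. 2154–2160] [cite: SGA4Tome3, Exp. XI Thm. 4.4] -/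
theorem baseChange_etPull_cmpAlong_b_ne_zero_iff_scheme (Bₛ : Cₛ.BettiPinning Tₛ τ' Hₛ rhoBₛ) (K : C5.SmallLevel C.S.K₀)
    (y : C.bettiH1 τ' K) :
    (M.etPull ℓ).baseChange (AlgebraicClosure ℚ_[ℓ]) (B.cmpAlong ℓ ι c (B.b K y)) ≠ 0 ↔
      schemeBettiPullAlong τ' (M.map K) (cA.cmp (C.X K) (C.alb K) y) ≠ 0 := by
  rw [M.baseChange_etPull_cmpAlong_b_ne_zero_iff ℓ ι c B Bₛ K, Ne, M.bettiPullAlong_albMap_eq_zero_iff cA K y]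

end Sec42Data.EtaleTowerHom

namespace Sec42Data.TowerHom

variable {Cₛ : Sec42Data P5ₛ isoₛ} {C : Sec42Data P5 iso} {Tₛ : Cₛ.HeckeTranslates} {T : C.HeckeTranslates}
  {φ : Cₛ.G →* C.G} {hφ : Continuous φ} (M : Sec42Data.TowerHom Cₛ C Tₛ T φ hφ) (ℓ : ℕ) [Fact ℓ.Prime]
variable {τ' : E →+* ℂ} (ι : ℂ ≃+* AlgebraicClosure ℚ_[ℓ]) (c : H1ComparisonFamily (E := E) τ' ℓ ι)
  (cA : AlbaneseH1ComparisonFamily E τ')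
variable {H Hₛ : Type} [AddCommGroup H] [Module ℂ H] [AddCommGroup Hₛ] [Module ℂ Hₛ]
  {rhoB : Representation ℂ C.G H} {rhoBₛ : Representation ℂ Cₛ.G Hₛ}
  (B : C.BettiPinning T τ' H rhoB) (Bₛ : Cₛ.BettiPinning Tₛ τ' Hₛ rhoBₛ)

/-- §2 for the LIFTED receptacle of a geometric `M : TowerHom …` (the form `S34SomeSource` quantifies): for a variety class `z`,
`(1 ⊗ M.toEtaleTowerHom.etPull) (cmp (b_K ((cmp_{X_K})⁻¹ z))) ≠ 0 ↔ (Sh(φ)_K ×_{τ'} ℂ)^* z ≠ 0`.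
[cite: Liu2021, Thm. 4.15 proof (FJcycle.tex l. 2199–2213); Lem. 2.4 (1); §4.3 l. 2154–2160] [cite: SGA4Tome3, Exp. XI Thm. 4.4] -/
theorem baseChange_etPull_toEtaleTowerHom_cmpAlong_b_albCmpEquiv_symm_ne_zero_iff
    (Bₛ : Cₛ.BettiPinning Tₛ τ' Hₛ rhoBₛ) (K : C5.SmallLevel C.S.K₀) (z : schemeBettiH1Along (C.X K) τ') :
    (M.toEtaleTowerHom.etPull ℓ).baseChange (AlgebraicClosure ℚ_[ℓ])
        (B.cmpAlong ℓ ι c (B.b K ((cA.cmpEquiv (C.X K) (C.alb K) (C.cpt.smooth_X K) (C.cpt.projective_X K)).symm z))) ≠ 0 ↔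
      schemeBettiPullAlong τ' (M.map K) z ≠ 0 :=
  M.toEtaleTowerHom.baseChange_etPull_cmpAlong_b_albCmpEquiv_symm_ne_zero_iff ℓ ι c cA B Bₛ K z

/-- §2 for the lifted receptacle, Albanese class: `(1 ⊗ M.toEtaleTowerHom.etPull) (cmp (b_K y)) ≠ 0 ↔ (Sh(φ)_K ×_{τ'} ℂ)^* (cmp_{X_K} y) ≠ 0`.
[cite: Liu2021, Thm. 4.15 proof (FJcycle.tex l. 2199–2213); Lem. 2.4 (1)] [cite: SGA4Tome3, Exp. XI Thm. 4.4] -/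
theorem baseChange_etPull_toEtaleTowerHom_cmpAlong_b_ne_zero_iff_scheme (Bₛ : Cₛ.BettiPinning Tₛ τ' Hₛ rhoBₛ)
    (K : C5.SmallLevel C.S.K₀) (y : C.bettiH1 τ' K) :
    (M.toEtaleTowerHom.etPull ℓ).baseChange (AlgebraicClosure ℚ_[ℓ]) (B.cmpAlong ℓ ι c (B.b K y)) ≠ 0 ↔
      schemeBettiPullAlong τ' (M.map K) (cA.cmp (C.X K) (C.alb K) y) ≠ 0 :=
  M.toEtaleTowerHom.baseChange_etPull_cmpAlong_b_ne_zero_iff_scheme ℓ ι c cA B Bₛ K y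

end Sec42Data.TowerHom

end Literature.NumberTheory.Automorphic.Liu2021.AppendixC

end
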